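/-
Copyright (c) 2026. All rights reserved.
Released under Apache 2.0 license as described in the file LICENSE.
Authors: HodgeCM publication cell (pub-hodgecm), GR lane, seat GR-1 (`pub-hodgecm-own-real34`).
-/
import Literature.NumberTheory.Automorphic.QuadExtPlacesAbove
import Literature.NumberTheory.Automorphic.UnitaryGroupAdelicOneTorus
import Literature.NumberTheory.GelbartRogawski1991.QuadExtSplittingCharArchRealPlaces
import HarnessLib

/-!
# The real places of a quadratic extension: `{w real} ≃ κ₂ ⊕ κ₂`

Topic `NumberTheory/GelbartRogawski1991` (it reuses `QuadExtSplittingCharArchRealPlaces`); namespace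
`Literature.NumberTheory.Automorphic.UnitaryGroup` (that of `QuadExtPlacesAbove`).  KERNEL only: definitions
with bodies and proved theorems; no `def … : Prop` record, no axiom, no `sorry`.  For a quadratic extension `E/F` of number
fields with non-trivial automorphism `c`, the real places of `E` are enumerated by two copies of the set `κ₂` of TYPE-(ii)
real places of `F` (`QuadExtPlacesAbove`: `v` real with a real place of `E` above it): `inl k ↦ w₂(k) = placeAboveTwo k`,
`inr k ↦ c⁻¹ • w₂(k)`.  Ingredients (reused): `Gal(E/F) = {1, c}` (`UnitaryGroupAdelicOneTorus.algEquiv_eq_one_or_eq`), a real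
place is moved by `c` and the places above `v = w|_F` are `w, c • w` (`QuadExtSplittingCharArchRealPlaces.smul_ne_of_isReal`,
`eq_or_eq_smul_of_isReal`, `comap_smul_eq'`), the places above `v` form one Galois orbit (Mathlib `exists_smul_eq_of_comap_eq`).

* `not_isTypeOne_comap : ¬ IsTypeOne ⟨w|_F⟩` for `w` real; `typeTwoBelow w : κ₂`;
* **`realPlacesEquivTypeTwo hc : κ₂ ⊕ κ₂ ≃ {w : InfinitePlace E // w.IsReal}`** with
  `realPlacesEquivTypeTwo_inl : _ (inl k) = placeAboveTwo k` and `realPlacesEquivTypeTwo_inr : _ (inr k) = ⟨c⁻¹ • w₂(k), _⟩`.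

This is the enumeration `eκ` consumed by the type-(ii) files of the `GelbartRogawski1991` archimedean half
(`DoubledUnitaryArchSiegelRealSign`, `…SignReps*`, `DoubledWeilRepresentationArchHalfReal`).  Written for the stage-1 cell
`pub-hodgecm` (seat GR-1); nothing here is a claim of the manuscripts adjudicated by that cell.

## References
* [CasselsFrohlichANT1967] J. W. S. Cassels, A. Fröhlich (eds.), *Algebraic Number Theory* (1967), Ch. II §14.
* [PlatonovRapinchuk1994] V. Platonov, A. Rapinchuk, *Algebraic Groups and Number Theory* (1994), §2.3.
-/

set_option autoImplicit false

noncomputable section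

open scoped Classical
open NumberField NumberField.InfinitePlace
open Literature.NumberTheory.GelbartRogawski1991.UnitaryDualPair.ArchSplitting

namespace Literature.NumberTheory.Automorphic

namespace UnitaryGroup

variable (F : Type) [Field F] [NumberField F] (E : Type) [Field E] [NumberField E] [Algebra F E]
  [Algebra.IsQuadraticExtension F E] (c : E ≃ₐ[F] E)

/-! ## §1 The Galois group `{1, c}` and real places -/

/-- `c * c = 1`, i.e. `c⁻¹ = c`, for `c ≠ 1`. [cite: PlatonovRapinchuk1994, §2.3] -/
theorem inv_eq_self_of_ne_one (hc : c ≠ 1) : c⁻¹ = c := by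
  rcases algEquiv_eq_one_or_eq F E c (Algebra.IsQuadraticExtension.finrank_eq_two F E) hc c⁻¹
    with h | h
  · exact absurd (inv_eq_one.mp h) hc
  · exact h

/-- **a real place of `E` lies over a type-(ii) place of `F`.** [cite: CasselsFrohlichANT1967, Ch. II §14] -/
theorem not_isTypeOne_comap (w : InfinitePlace E) (hw : w.IsReal) :
    ¬ IsTypeOne F E ⟨w.comap (algebraMap F E), hw.comap _⟩ := by
  intro h
  change (placeAbove F E (w.comap (algebraMap F E))).IsComplex at h
  obtain ⟨σ, hσ⟩ := exists_smul_eq_of_comap_eq (k := F) (w := w)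
    (w' := placeAbove F E (w.comap (algebraMap F E))) (by rw [placeAbove_comap])
  rw [← hσ, ← not_isReal_iff_isComplex, isReal_smul_iff] at h
  exact h hw

/-- the type-(ii) place of `F` below a real place of `E`. [cite: CasselsFrohlichANT1967, Ch. II §14] -/
def typeTwoBelow (w : {w : InfinitePlace E // w.IsReal}) :
    {v : {v : InfinitePlace F // v.IsReal} // ¬ IsTypeOne F E v} :=
  ⟨⟨w.1.comap (algebraMap F E), w.2.comap _⟩, not_isTypeOne_comap F E w.1 w.2⟩

/-- `typeTwoBelow (placeAboveTwo k) = k`. [cite: CasselsFrohlichANT1967, Ch. II §14] -/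
@[simp] theorem typeTwoBelow_placeAboveTwo (k : {v : {v : InfinitePlace F // v.IsReal} // ¬ IsTypeOne F E v}) :
    typeTwoBelow F E (placeAboveTwo F E k) = k :=
  Subtype.ext (Subtype.ext (placeAboveTwo_comap F E k))

/-- `typeTwoBelow (σ • w) = typeTwoBelow w`. [cite: CasselsFrohlichANT1967, Ch. II §14] -/
theorem typeTwoBelow_smul (σ : E ≃ₐ[F] E) (w : {w : InfinitePlace E // w.IsReal}) :
    typeTwoBelow F E ⟨σ • w.1, isReal_smul_iff.mpr w.2⟩ = typeTwoBelow F E w :=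
  Subtype.ext (Subtype.ext (QuadExt.comap_smul_eq' F E σ w.1))

/-- **every real place of `E` is `w₂(k)` or `c • w₂(k)`** for the type-(ii) place `k` below it (`c ≠ 1`).
[cite: CasselsFrohlichANT1967, Ch. II §14] -/
theorem eq_placeAboveTwo_or_eq_smul (hc : c ≠ 1) (w : {w : InfinitePlace E // w.IsReal}) :
    w = placeAboveTwo F E (typeTwoBelow F E w) ∨
      w = ⟨c • (placeAboveTwo F E (typeTwoBelow F E w)).1, isReal_smul_iff.mpr (placeAboveTwo F E (typeTwoBelow F E w)).2⟩ := by
  obtain ⟨σ, hσ⟩ := exists_smul_eq_of_comap_eq (k := F) (w := (placeAboveTwo F E (typeTwoBelow F E w)).1)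
    (w' := w.1) (by rw [placeAboveTwo_comap]; rfl)
  rcases algEquiv_eq_one_or_eq F E c (Algebra.IsQuadraticExtension.finrank_eq_two F E) hc σ with rfl | rfl
  · rw [one_smul] at hσ
    exact Or.inl (Subtype.ext hσ.symm)
  · exact Or.inr (Subtype.ext hσ.symm)

/-! ## §2 The enumeration `κ₂ ⊕ κ₂ ≃ {w real}` -/

/-- the enumeration map `inl k ↦ w₂(k)`, `inr k ↦ c⁻¹ • w₂(k)`. [cite: CasselsFrohlichANT1967, Ch. II §14] -/
def realPlacesOfTypeTwo :
    {v : {v : InfinitePlace F // v.IsReal} // ¬ IsTypeOne F E v} ⊕ {v : {v : InfinitePlace F // v.IsReal} // ¬ IsTypeOne F E v} →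
      {w : InfinitePlace E // w.IsReal} :=
  Sum.elim (placeAboveTwo F E) fun k => ⟨c⁻¹ • (placeAboveTwo F E k).1, isReal_smul_iff.mpr (placeAboveTwo F E k).2⟩

/-- it is bijective (`c ≠ 1`). [cite: CasselsFrohlichANT1967, Ch. II §14] -/
theorem realPlacesOfTypeTwo_bijective (hc : c ≠ 1) : Function.Bijective (realPlacesOfTypeTwo F E c) := by
  have hinv : c⁻¹ = c := inv_eq_self_of_ne_one F E c hc
  have hne : ∀ k : {v : {v : InfinitePlace F // v.IsReal} // ¬ IsTypeOne F E v},
      (⟨c⁻¹ • (placeAboveTwo F E k).1, isReal_smul_iff.mpr (placeAboveTwo F E k).2⟩ :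
        {w : InfinitePlace E // w.IsReal}) ≠ placeAboveTwo F E k := by
    intro k h
    rw [hinv] at h
    exact QuadExt.smul_ne_of_isReal F E c (placeAboveTwo F E k) hc (congrArg Subtype.val h)
  have hbelow : ∀ k : {v : {v : InfinitePlace F // v.IsReal} // ¬ IsTypeOne F E v},
      typeTwoBelow F E ⟨c⁻¹ • (placeAboveTwo F E k).1, isReal_smul_iff.mpr (placeAboveTwo F E k).2⟩ = k := by
    intro k; rw [typeTwoBelow_smul, typeTwoBelow_placeAboveTwo]
  refine ⟨?_, ?_⟩
  · rintro (k | k) (k' | k') h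
    · simpa [realPlacesOfTypeTwo] using congrArg (typeTwoBelow F E) h
    · have hk : k = k' := by simpa [realPlacesOfTypeTwo, hbelow] using congrArg (typeTwoBelow F E) h
      subst hk
      exact absurd h.symm (hne k)
    · have hk : k = k' := by simpa [realPlacesOfTypeTwo, hbelow] using congrArg (typeTwoBelow F E) h
      subst hk
      exact absurd h (hne k)
    · simpa [realPlacesOfTypeTwo, hbelow] using congrArg (typeTwoBelow F E) h
  · intro w
    rcases eq_placeAboveTwo_or_eq_smul F E c hc w with h | h
    · exact ⟨Sum.inl (typeTwoBelow F E w), h.symm⟩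
    · refine ⟨Sum.inr (typeTwoBelow F E w), ?_⟩
      simp only [realPlacesOfTypeTwo, Sum.elim_inr, hinv]
      exact h.symm

/-- **THE ENUMERATION OF THE REAL PLACES OF `E` BY THE TYPE-(ii) PLACES OF `F`**: `κ₂ ⊕ κ₂ ≃ {w real}`,
`inl k ↦ w₂(k)`, `inr k ↦ c⁻¹ • w₂(k)` (`c ≠ 1`). [cite: CasselsFrohlichANT1967, Ch. II §14] [cite: PlatonovRapinchuk1994, §2.3] -/
def realPlacesEquivTypeTwo (hc : c ≠ 1) :
    {v : {v : InfinitePlace F // v.IsReal} // ¬ IsTypeOne F E v} ⊕ {v : {v : InfinitePlace F // v.IsReal} // ¬ IsTypeOne F E v} ≃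
      {w : InfinitePlace E // w.IsReal} :=
  Equiv.ofBijective (realPlacesOfTypeTwo F E c) (realPlacesOfTypeTwo_bijective F E c hc)

/-- `realPlacesEquivTypeTwo (inl k) = w₂(k)`. [cite: CasselsFrohlichANT1967, Ch. II §14] -/
@[simp] theorem realPlacesEquivTypeTwo_inl (hc : c ≠ 1) (k : {v : {v : InfinitePlace F // v.IsReal} // ¬ IsTypeOne F E v}) :
    realPlacesEquivTypeTwo F E c hc (Sum.inl k) = placeAboveTwo F E k := rfl

/-- `realPlacesEquivTypeTwo (inr k) = c⁻¹ • w₂(k)`. [cite: CasselsFrohlichANT1967, Ch. II §14] -/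
@[simp] theorem realPlacesEquivTypeTwo_inr (hc : c ≠ 1) (k : {v : {v : InfinitePlace F // v.IsReal} // ¬ IsTypeOne F E v}) :
    realPlacesEquivTypeTwo F E c hc (Sum.inr k) =
      ⟨c⁻¹ • (placeAboveTwo F E k).1, isReal_smul_iff.mpr (placeAboveTwo F E k).2⟩ := rfl

end UnitaryGroup

end Literature.NumberTheory.Automorphic

end
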